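import Summits.Ventures.Crystal3D.Theorems.StickyWulffConstantCoaxialWallLawGeneralRung
import Summits.Ventures.Crystal3D.Theorems.StickyWulffConstantCoaxialWallLawInPlaneSlotSharp
import HarnessLib

/-!
# The co-axial general-filling rung, CERTIFIED form: charge `√6/4 > ½` modulo the foreign twin caps, under the C12-55 row

HONEST FRAMING. Part of the venture `Summits/Ventures/Crystal3D` (cell `crystal3d-full`), helper
`--supports` the crux `CoaxialWallLaw` (stmt-Ventures-19481, `route-Ventures-StickyWulffConstant`),
REGISTERED line `WallLedgerF` (planner cf-p1 gen 16), stub `stub_coaxialTwoSlabAdhesion` (THE CRUX of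
the line: ARBITRARY fillings, charge `½ · sin θ`).  Second capstone of the in-plane general-filling port
(this seat, gen 4), replacing the payer mechanism of `coaxialTwoSlabAdhesion_modulo_foreignCaps`
(`exit_trichotomy`: an unsaturated ball within contact distance three, shared by `≤ 1885` exits; charge
`√6/11310`) by 19480-p2's CERTIFIED exit step `exit_unsaturated_or_twinCap` (`…GenericWallFloorExitCertified`):
under ONE `ExactOnly` row — C12-55, the closed vertex star, taken BY NAME as
`ExactOnly 0 {w ∈ fccSlots | 0 < ⟪w, s₀⟫}` exactly as lane G's chain ledger `twoSlabAdhesion_chainLedger`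
does (its kernel certificate is cf-p2's pre-registered R39c; NOT yet a tree theorem) — every exit is ITSELF
unsaturated or an exact twin cap: credit AT the exit, no sharing.  Together with the SHARP in-plane flux
(`exists_inPlane_slot_of_coaxial_sharp`: the best of the three in-plane classes carries
`√2 |⟪A₁ w, e₃⟫| ≥ (√6/2) · sin θ`, from `max(4p², (p+q)², (p−q)²) ≥ 3p² + q²`) this gives the
co-axial wall term with the RIGID RUNG'S constant `√6/4 = 0.612… > ½ = c₁`.  Rung credit only; F-C1 not moved.

**Theorem (`coaxialTwoSlabAdhesion_modulo_foreignCaps_certified`).**  `Λ₁ = A₁·Λ₀ + t₁` co-axial with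
the frame `L` (`Λ₁ ⊆ L·B(σ) + s₁`, `σ` Hägg; `sin θ = √(1 − ⟪L e₃, e₃⟫²)`), `Λ₂ ≠ Λ₁` ANY moved fcc lattice,
`hcert : ExactOnly 0 {w ∈ fccSlots | 0 < ⟪w, s₀⟫}` for one slot `s₀`.  Then there are an in-plane
non-descending slot `w` of grain 1 and `C`, `R₀ = 10` such that in EVERY cell of `CoaxialTwoSlabAdhesion`
(ARBITRARY unit-separated filling; clean outer slivers as in lane G's capstones):

  `cross(P₁, X∖P₁) + cross(P₂, Y) ≤ D(Y) + (φ₁ + φ₂ − (√6/4)·sin θ) π ρ² + ½ · #FTC + C (1 + h) ρ`,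

`FTC` = the located in-plane `w`-exits of grain 1 that are EXACT TWIN CAPS WITH A FOREIGN NORMAL `n ≠ ±L e₃`
(lane G's `TC` predicate verbatim plus `n ≠ ±m`; coherent terraces and stacking faults never cap an in-plane
line, `twinCap_normal_ne_axis_of_inPlane`).  Since `√6/4 > ½`, THIS IS THE STUB'S INEQUALITY WITH ROOM, for
general fillings, MODULO: (a) the foreign-cap residual `½ · #FTC` (lane G's residual class — foreign twin
lamellae inside the co-axial cell), (b) the C12-55 certificate, (c) the two clean-sliver hypotheses.
`…_certified_of_coaxial` restates it with the crux's quantifier prefix.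

Assembly: `2 D(X) = Σ(12 − deg) ≥ 2(φ₁+φ₂)πρ² + #payers − C(1+h)ρ` (`coaxial_ledger_ge_faces_add_payers`),
`#payers ≥ #EX − #FTC` (`card_exits_le_certified`: a non-capped exit is its own payer),
`#EX ≥ √2|⟪A₁w,e₃⟫| π(ρ−1)² − O((1+h)ρ)` (`card_located_exits_ge`), flux `≥ (√6/2) sin θ`, stub algebra.

WHAT THIS IS NOT: not the stub (residual `½·#FTC`; conditional on the C12-55 `ExactOnly` row; clean
slivers assumed); no claim about foreign caps; F-C1 not moved.
-/

noncomputable section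

namespace Summit.Ventures.Crystal3D.Theorems

open Summit.Ventures.Crystal3D Finset
open Literature.MathematicalPhysics.StatisticalMechanics (fccStacking barlowStacking IsHaggSeq contactDeficiency
  triangularVec₁ triangularVec₂)
open scoped InnerProductSpace

/-! ### The certified co-axial rung -/

open scoped Classical in
/-- **The co-axial general-filling rung, certified form** (charge `√6/4`, residual `½·#FTC`).  See the
module docstring. -/
theorem coaxialTwoSlabAdhesion_modulo_foreignCaps_certified
    {s₀ : EuclideanSpace ℝ (Fin 3)} (hs₀ : s₀ ∈ fccSlots)
    (hcert : ExactOnly 0 (fccSlots.filter fun w => 0 < ⟪w, s₀⟫_ℝ))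
    (A₁ : EuclideanSpace ℝ (Fin 3) ≃ₗᵢ[ℝ] EuclideanSpace ℝ (Fin 3)) (t₁ : EuclideanSpace ℝ (Fin 3))
    (A₂ : EuclideanSpace ℝ (Fin 3) ≃ₗᵢ[ℝ] EuclideanSpace ℝ (Fin 3)) (t₂ : EuclideanSpace ℝ (Fin 3))
    (L : EuclideanSpace ℝ (Fin 3) ≃ₗᵢ[ℝ] EuclideanSpace ℝ (Fin 3)) (s₁ : EuclideanSpace ℝ (Fin 3))
    {σ : ℤ → ℤ} (hσ : IsHaggSeq σ)
    (hsub₁ : (fun p => A₁ p + t₁) '' fccStacking 1 (Real.sqrt (2 / 3)) ⊆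
      (fun p => L p + s₁) '' barlowStacking 1 (Real.sqrt (2 / 3)) σ)
    (hne : (fun p => A₁ p + t₁) '' fccStacking 1 (Real.sqrt (2 / 3)) ≠
      (fun p => A₂ p + t₂) '' fccStacking 1 (Real.sqrt (2 / 3))) :
    ∃ w ∈ fccSlots, ⟪A₁ w, L (EuclideanSpace.single (2 : Fin 3) (1 : ℝ))⟫_ℝ = 0 ∧
      0 ≤ ⟪A₁ w, EuclideanSpace.single (2 : Fin 3) (1 : ℝ)⟫_ℝ ∧
    ∃ C R₀ : ℝ, 1 ≤ R₀ ∧ ∀ h : ℝ, 0 ≤ h → ∀ ρ : ℝ, R₀ ≤ ρ →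
      ∀ X P₁ P₂ : Finset (EuclideanSpace ℝ (Fin 3)),
      (∀ p ∈ X, ∀ q ∈ X, p ≠ q → 1 ≤ dist p q) → P₁ ⊆ X → P₂ ⊆ X \ P₁ →
      (∀ p ∈ X, -(2 * R₀) ≤ p 2 ∧ p 2 ≤ h + 2 * R₀ ∧ p 0 ^ 2 + p 1 ^ 2 ≤ ρ ^ 2) →
      (∀ p, p ∈ P₁ ↔ (p ∈ (fun q => A₁ q + t₁) '' fccStacking 1 (Real.sqrt (2 / 3)) ∧
        -(2 * R₀) ≤ p 2 ∧ p 2 ≤ -R₀ ∧ p 0 ^ 2 + p 1 ^ 2 ≤ ρ ^ 2)) →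
      (∀ p, p ∈ P₂ ↔ (p ∈ (fun q => A₂ q + t₂) '' fccStacking 1 (Real.sqrt (2 / 3)) ∧
        h + R₀ ≤ p 2 ∧ p 2 ≤ h + 2 * R₀ ∧ p 0 ^ 2 + p 1 ^ 2 ≤ ρ ^ 2)) →
      -- CLEAN outer slivers
      (∀ p ∈ X, p 2 < -(2 * R₀) + 1 → p ∈ (fun q => A₁ q + t₁) '' fccStacking 1 (Real.sqrt (2 / 3))) →
      (∀ p ∈ X, h + 2 * R₀ - 1 < p 2 → p ∈ (fun q => A₂ q + t₂) '' fccStacking 1 (Real.sqrt (2 / 3))) →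
      ((((P₁ ×ˢ (X \ P₁)).filter fun pq => dist pq.1 pq.2 = 1).card : ℕ) : ℝ) +
        ((((P₂ ×ˢ ((X \ P₁) \ P₂)).filter fun pq => dist pq.1 pq.2 = 1).card : ℕ) : ℝ) ≤
        contactDeficiency ((X \ P₁) \ P₂) +
          (Real.sqrt 2 / 4 * ∑ᶠ w ∈ {w ∈ fccStacking 1 (Real.sqrt (2 / 3)) | ‖w‖ = 1},
              |⟪w, A₁.symm (EuclideanSpace.single (2 : Fin 3) (1 : ℝ))⟫_ℝ| +
            Real.sqrt 2 / 4 * ∑ᶠ w ∈ {w ∈ fccStacking 1 (Real.sqrt (2 / 3)) | ‖w‖ = 1},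
              |⟪w, A₂.symm (EuclideanSpace.single (2 : Fin 3) (1 : ℝ))⟫_ℝ| -
            Real.sqrt 6 / 4 * Real.sqrt (1 - ⟪L (EuclideanSpace.single (2 : Fin 3) (1 : ℝ)),
              EuclideanSpace.single (2 : Fin 3) (1 : ℝ)⟫_ℝ ^ 2)) * Real.pi * ρ ^ 2 +
          1 / 2 * ((((X.filter fun e => (e ∈ (fun q => A₁ q + t₁) '' fccStacking 1 (Real.sqrt (2 / 3)) ∧
                e 2 < h + R₀ + 2 ∧ e 0 ^ 2 + e 1 ^ 2 ≤ (ρ - 3) ^ 2) ∧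
                e - A₁ w ∈ X ∧ (∀ v ∈ fccSlots, e - A₁ w + A₁ v ∈ X) ∧
                ∃ v ∈ fccSlots, e + A₁ v ∉ X).filter fun e => ∃ n : EuclideanSpace ℝ (Fin 3), ‖n‖ = 1 ∧
              n ≠ L (EuclideanSpace.single (2 : Fin 3) (1 : ℝ)) ∧
              n ≠ -L (EuclideanSpace.single (2 : Fin 3) (1 : ℝ)) ∧
              (∀ v ∈ fccSlots, ⟪A₁ v, n⟫_ℝ = 0 ∨ ⟪A₁ v, n⟫_ℝ = Real.sqrt (2 / 3) ∨
                ⟪A₁ v, n⟫_ℝ = -Real.sqrt (2 / 3)) ∧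
              ⟪A₁ w, n⟫_ℝ = Real.sqrt (2 / 3) ∧
              (∀ v ∈ fccSlots, ⟪A₁ v, n⟫_ℝ ≤ 0 → e + A₁ v ∈ X) ∧
              (∀ v ∈ fccSlots, 0 < ⟪A₁ v, n⟫_ℝ → e + A₁ v ∉ X ∧ e - A₁ v + (2 * ⟪A₁ v, n⟫_ℝ) • n ∈ X)).card
              : ℕ) : ℝ) +
          C * (1 + h) * ρ := by
  obtain ⟨w, hw, hw0, hwup, hflux⟩ := exists_inPlane_slot_of_coaxial_sharp A₁ t₁ L s₁ hσ hsub₁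
  obtain ⟨C₁, hC₁⟩ := affineSampleDeficit_upper A₁ t₁ 10 (by norm_num)
  obtain ⟨C₂, hC₂⟩ := affineSampleDeficit_upper A₂ t₂ 10 (by norm_num)
  refine ⟨w, hw, hw0, hwup, (240 * Real.sqrt 2 * Real.pi + 3120 * (4 * 10 + 2)) / 2 + 1310 + |C₁| + |C₂|, 10,
    by norm_num, ?_⟩
  intro h hh ρ hρ X P₁ P₂ hX hP₁X hP₂X hcell hP₁ hP₂ hclean₁ hclean₂
  set φ₁ : ℝ := Real.sqrt 2 / 4 * ∑ᶠ w ∈ {w ∈ fccStacking 1 (Real.sqrt (2 / 3)) | ‖w‖ = 1},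
      |⟪w, A₁.symm (EuclideanSpace.single (2 : Fin 3) (1 : ℝ))⟫_ℝ| with hφ₁
  set φ₂ : ℝ := Real.sqrt 2 / 4 * ∑ᶠ w ∈ {w ∈ fccStacking 1 (Real.sqrt (2 / 3)) | ‖w‖ = 1},
      |⟪w, A₂.symm (EuclideanSpace.single (2 : Fin 3) (1 : ℝ))⟫_ℝ| with hφ₂
  have hP₂X' : P₂ ⊆ X := hP₂X.trans Finset.sdiff_subset
  have hρ0 : (0 : ℝ) ≤ ρ := by linarith
  -- the three counted families, in the syntactic form of the statement
  set EXS : Finset (EuclideanSpace ℝ (Fin 3)) := X.filter fun e =>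
    (e ∈ (fun q => A₁ q + t₁) '' fccStacking 1 (Real.sqrt (2 / 3)) ∧
      e 2 < h + 10 + 2 ∧ e 0 ^ 2 + e 1 ^ 2 ≤ (ρ - 3) ^ 2) ∧
      e - A₁ w ∈ X ∧ (∀ v ∈ fccSlots, e - A₁ w + A₁ v ∈ X) ∧ ∃ v ∈ fccSlots, e + A₁ v ∉ X with hEXS
  set FTCS : Finset (EuclideanSpace ℝ (Fin 3)) := EXS.filter fun e => ∃ n : EuclideanSpace ℝ (Fin 3), ‖n‖ = 1 ∧
      n ≠ L (EuclideanSpace.single (2 : Fin 3) (1 : ℝ)) ∧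
      n ≠ -L (EuclideanSpace.single (2 : Fin 3) (1 : ℝ)) ∧
      (∀ v ∈ fccSlots, ⟪A₁ v, n⟫_ℝ = 0 ∨ ⟪A₁ v, n⟫_ℝ = Real.sqrt (2 / 3) ∨
        ⟪A₁ v, n⟫_ℝ = -Real.sqrt (2 / 3)) ∧
      ⟪A₁ w, n⟫_ℝ = Real.sqrt (2 / 3) ∧
      (∀ v ∈ fccSlots, ⟪A₁ v, n⟫_ℝ ≤ 0 → e + A₁ v ∈ X) ∧
      (∀ v ∈ fccSlots, 0 < ⟪A₁ v, n⟫_ℝ → e + A₁ v ∉ X ∧ e - A₁ v + (2 * ⟪A₁ v, n⟫_ℝ) • n ∈ X)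
    with hFTCS
  set PAYS : Finset (EuclideanSpace ℝ (Fin 3)) := X.filter fun y => (X.filter fun q => dist y q = 1).card ≠ 12 ∧
    ∃ e ∈ X, ((e ∈ (fun q => A₁ q + t₁) '' fccStacking 1 (Real.sqrt (2 / 3)) ∧
        e 2 < h + 10 + 2 ∧ e 0 ^ 2 + e 1 ^ 2 ≤ (ρ - 3) ^ 2) ∧
        e - A₁ w ∈ X ∧ (∀ v ∈ fccSlots, e - A₁ w + A₁ v ∈ X) ∧ ∃ v ∈ fccSlots, e + A₁ v ∉ X) ∧
      (y = e ∨ dist e y = 1 ∨ (∃ z ∈ X, dist e z = 1 ∧ dist z y = 1) ∨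
        ∃ z ∈ X, ∃ z' ∈ X, dist e z = 1 ∧ dist z z' = 1 ∧ dist z' y = 1) with hPAYS
  -- the located exits: on `Λ₁`, below `h + R₀ + 2`, off the rim
  have hQc : ∀ e ∈ X, (e ∈ (fun q => A₁ q + t₁) '' fccStacking 1 (Real.sqrt (2 / 3)) ∧
      e 2 < h + 10 + 2 ∧ e 0 ^ 2 + e 1 ^ 2 ≤ (ρ - 3) ^ 2) → e - A₁ w ∈ X →
      (∀ v ∈ fccSlots, e - A₁ w + A₁ v ∈ X) → e 2 < h + 12 := by
    intro e _ hQe _ _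
    have := hQe.2.1
    linarith
  -- the ledger with payers
  have hled : 2 * φ₁ * Real.pi * ρ ^ 2 + 2 * φ₂ * Real.pi * ρ ^ 2 + ((PAYS.card : ℕ) : ℝ) -
      (240 * Real.sqrt 2 * Real.pi + 3120 * (4 * 10 + 2)) * (1 + h) * ρ ≤
      ∑ x ∈ X, ((12 : ℝ) - ((X.filter fun q => dist x q = 1).card : ℝ)) := by
    have h0 := coaxial_ledger_ge_faces_add_payers A₁ t₁ A₂ t₂ X P₁ P₂ 10 h ρ le_rfl hh hρ hX hcell hP₁X hP₂X'
      hP₁ hP₂ hclean₁ hclean₂ hw hwup (fun e => e ∈ (fun q => A₁ q + t₁) '' fccStacking 1 (Real.sqrt (2 / 3)) ∧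
        e 2 < h + 10 + 2 ∧ e 0 ^ 2 + e 1 ^ 2 ≤ (ρ - 3) ^ 2) (h + 12) (by linarith) hQc
    rw [← finsum_unit_fcc_symm_eq_sum_slots A₁, ← finsum_unit_fcc_symm_eq_sum_slots A₂, ← hφ₁, ← hφ₂] at h0
    convert h0 using 4
  -- sources: the located exits along `w`
  have hEX : Real.sqrt 2 * |⟪A₁ w, EuclideanSpace.single (2 : Fin 3) (1 : ℝ)⟫_ℝ| * Real.pi * (ρ - 1) ^ 2 -
      10 * Real.sqrt 2 * Real.pi * (ρ - 1) - 30 * (h + 4 * 10 + 2) * (2 * ρ - 3) ≤ ((EXS.card : ℕ) : ℝ) := by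
    have h0 := card_located_exits_ge A₁ t₁ A₂ t₂ hne X P₁ P₂ 10 h ρ (by norm_num) hh hρ hX hP₁X hP₂X' hcell
      hP₁ hP₂ hw
    convert h0 using 3
  -- sinks: certified exits pay at the exit or are (foreign) caps
  have hPAY' : ((EXS.card : ℕ) : ℝ) ≤ ((FTCS.card : ℕ) : ℝ) + ((PAYS.card : ℕ) : ℝ) := by
    have h0 := card_exits_le_certified hX hs₀ hcert A₁ hw (fun e =>
      e ∈ (fun q => A₁ q + t₁) '' fccStacking 1 (Real.sqrt (2 / 3)) ∧
        e 2 < h + 10 + 2 ∧ e 0 ^ 2 + e 1 ^ 2 ≤ (ρ - 3) ^ 2)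
    rw [filter_twinCapped_eq_foreign_of_inPlane A₁ L X _ hw0] at h0
    have h1 : EXS.card ≤ FTCS.card + PAYS.card := by convert h0 using 6
    exact_mod_cast h1
  -- the flux `f = √2 |⟪A₁ w, e₃⟫| ≥ (√6/2) sin θ`, and `f π (ρ−1)² − rim ≥ f π ρ² − 2620 (1+h) ρ`
  set f : ℝ := Real.sqrt 2 * |⟪A₁ w, EuclideanSpace.single (2 : Fin 3) (1 : ℝ)⟫_ℝ| with hf
  set s : ℝ := Real.sqrt (1 - ⟪L (EuclideanSpace.single (2 : Fin 3) (1 : ℝ)),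
    EuclideanSpace.single (2 : Fin 3) (1 : ℝ)⟫_ℝ ^ 2) with hs
  have hf0 : 0 ≤ f := by positivity
  have hs2 : Real.sqrt 2 ≤ 2 := by
    rw [show (2 : ℝ) = Real.sqrt (2 ^ 2) by rw [Real.sqrt_sq (by norm_num)]]
    exact Real.sqrt_le_sqrt (by norm_num)
  have hfle : f ≤ 2 := by
    have h1 := abs_inner_slot_le_one A₁ hw
    have h2 : 0 ≤ Real.sqrt 2 := Real.sqrt_nonneg 2
    calc f = Real.sqrt 2 * |⟪A₁ w, EuclideanSpace.single (2 : Fin 3) (1 : ℝ)⟫_ℝ| := rfl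
      _ ≤ 2 * 1 := mul_le_mul hs2 h1 (abs_nonneg _) (by norm_num)
      _ = 2 := by ring
  have hπ : Real.pi ≤ 4 := Real.pi_le_four
  have hπ0 : 0 ≤ Real.pi := Real.pi_pos.le
  have hsq : 0 ≤ Real.sqrt 2 := Real.sqrt_nonneg 2
  have hflux6 : Real.sqrt 6 * s * Real.pi * ρ ^ 2 ≤ 2 * f * Real.pi * ρ ^ 2 := by
    have h0 : (0 : ℝ) ≤ Real.pi * ρ ^ 2 := by positivity
    have := mul_le_mul_of_nonneg_right hflux h0
    nlinarith only [this]
  have hkey : f * Real.pi * ρ ^ 2 - 2620 * (1 + h) * ρ ≤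
      f * Real.pi * (ρ - 1) ^ 2 - 10 * Real.sqrt 2 * Real.pi * (ρ - 1) - 30 * (h + 4 * 10 + 2) * (2 * ρ - 3) := by
    have e : f * Real.pi * (ρ - 1) ^ 2 - 10 * Real.sqrt 2 * Real.pi * (ρ - 1) -
        30 * (h + 4 * 10 + 2) * (2 * ρ - 3) - (f * Real.pi * ρ ^ 2 - 2620 * (1 + h) * ρ) =
        (2620 * ρ - 2 * (f * Real.pi * ρ) - 10 * (Real.sqrt 2 * Real.pi * ρ) - 2520 * ρ) +
          (2620 * (h * ρ) - 60 * (h * ρ)) + f * Real.pi + 10 * (Real.sqrt 2 * Real.pi) + 90 * h + 3780 := by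
      ring
    have h1 : 0 ≤ h * ρ := mul_nonneg hh hρ0
    have h2 : 0 ≤ Real.sqrt 2 * Real.pi := mul_nonneg hsq hπ0
    have h3 : f * Real.pi * ρ ≤ 8 * ρ := by
      have : f * Real.pi ≤ 8 := by nlinarith only [hfle, hπ, hπ0, hf0]
      exact mul_le_mul_of_nonneg_right this hρ0
    have h4 : Real.sqrt 2 * Real.pi * ρ ≤ 8 * ρ := by
      have : Real.sqrt 2 * Real.pi ≤ 8 := by nlinarith only [hs2, hπ, hπ0, hsq]
      exact mul_le_mul_of_nonneg_right this hρ0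
    have h5 : 0 ≤ f * Real.pi := mul_nonneg hf0 hπ0
    linarith only [e, h1, h2, h3, h4, h5, hh, hρ0]
  -- the two upper slab counts and the two splits
  have hD₁ := hC₁ (-(2 * 10)) (-10) (by ring) ρ hρ P₁ hP₁
  have hD₂ := hC₂ (h + 10) (h + 2 * 10) (by ring) ρ hρ P₂ hP₂
  have hsplit₁ := contactDeficiency_sdiff_split hP₁X
  have hsplit₂ := contactDeficiency_sdiff_split hP₂X
  have htwo := two_mul_contactDeficiency_eq_sum X
  -- constants
  have hb : C₁ * ρ ≤ |C₁| * (1 + h) * ρ := by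
    have h1 : 0 ≤ (|C₁| - C₁) * ρ := mul_nonneg (by linarith only [le_abs_self C₁]) hρ0
    have h2 : 0 ≤ |C₁| * h * ρ := by positivity
    linarith only [h1, h2]
  have hc' : C₂ * ρ ≤ |C₂| * (1 + h) * ρ := by
    have h1 : 0 ≤ (|C₂| - C₂) * ρ := mul_nonneg (by linarith only [le_abs_self C₂]) hρ0
    have h2 : 0 ≤ |C₂| * h * ρ := by positivity
    linarith only [h1, h2]
  have hhρ : 0 ≤ h * ρ := mul_nonneg hh hρ0
  linarith only [hled, hEX, hPAY', hflux6, hkey, hD₁, hD₂, hsplit₁, hsplit₂, htwo, hb, hc', hρ0, hh, hhρ, hπ0]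

open scoped Classical in
/-- **The certified rung with the crux's quantifier prefix.**  Under the hypotheses of
`stub_coaxialTwoSlabAdhesion` and the C12-55 row: for the frame `L` of the hypothesis there are an in-plane
non-descending slot `w` of grain 1 and `C`, `R₀` with the inequality of
`coaxialTwoSlabAdhesion_modulo_foreignCaps_certified` in every cell with clean outer slivers
(main term `(φ₁ + φ₂ − (√6/4) sin θ) π ρ²`, i.e. the stub's with room since `√6/4 > ½`; residual `½·#FTC`). -/
theorem coaxialTwoSlabAdhesion_modulo_foreignCaps_certified_of_coaxial
    {s₀ : EuclideanSpace ℝ (Fin 3)} (hs₀ : s₀ ∈ fccSlots)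
    (hcert : ExactOnly 0 (fccSlots.filter fun w => 0 < ⟪w, s₀⟫_ℝ))
    (A₁ : EuclideanSpace ℝ (Fin 3) ≃ₗᵢ[ℝ] EuclideanSpace ℝ (Fin 3)) (t₁ : EuclideanSpace ℝ (Fin 3))
    (A₂ : EuclideanSpace ℝ (Fin 3) ≃ₗᵢ[ℝ] EuclideanSpace ℝ (Fin 3)) (t₂ : EuclideanSpace ℝ (Fin 3))
    (hcoax : ∃ (L : EuclideanSpace ℝ (Fin 3) ≃ₗᵢ[ℝ] EuclideanSpace ℝ (Fin 3))
        (s₁ s₂ : EuclideanSpace ℝ (Fin 3)) (σ σ' : ℤ → ℤ), IsHaggSeq σ ∧ IsHaggSeq σ' ∧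
        (fun p => A₁ p + t₁) '' fccStacking 1 (Real.sqrt (2 / 3)) ⊆
          (fun p => L p + s₁) '' barlowStacking 1 (Real.sqrt (2 / 3)) σ ∧
        (fun p => A₂ p + t₂) '' fccStacking 1 (Real.sqrt (2 / 3)) ⊆
          (fun p => L p + s₂) '' barlowStacking 1 (Real.sqrt (2 / 3)) σ')
    (hne : (fun p => A₁ p + t₁) '' fccStacking 1 (Real.sqrt (2 / 3)) ≠
      (fun p => A₂ p + t₂) '' fccStacking 1 (Real.sqrt (2 / 3))) :
    ∃ (L : EuclideanSpace ℝ (Fin 3) ≃ₗᵢ[ℝ] EuclideanSpace ℝ (Fin 3))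
        (s₁ s₂ : EuclideanSpace ℝ (Fin 3)) (σ σ' : ℤ → ℤ), IsHaggSeq σ ∧ IsHaggSeq σ' ∧
        (fun p => A₁ p + t₁) '' fccStacking 1 (Real.sqrt (2 / 3)) ⊆
          (fun p => L p + s₁) '' barlowStacking 1 (Real.sqrt (2 / 3)) σ ∧
        (fun p => A₂ p + t₂) '' fccStacking 1 (Real.sqrt (2 / 3)) ⊆
          (fun p => L p + s₂) '' barlowStacking 1 (Real.sqrt (2 / 3)) σ' ∧
    ∃ w ∈ fccSlots, ⟪A₁ w, L (EuclideanSpace.single (2 : Fin 3) (1 : ℝ))⟫_ℝ = 0 ∧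
      0 ≤ ⟪A₁ w, EuclideanSpace.single (2 : Fin 3) (1 : ℝ)⟫_ℝ ∧
    ∃ C R₀ : ℝ, 1 ≤ R₀ ∧ ∀ h : ℝ, 0 ≤ h → ∀ ρ : ℝ, R₀ ≤ ρ →
      ∀ X P₁ P₂ : Finset (EuclideanSpace ℝ (Fin 3)),
      (∀ p ∈ X, ∀ q ∈ X, p ≠ q → 1 ≤ dist p q) → P₁ ⊆ X → P₂ ⊆ X \ P₁ →
      (∀ p ∈ X, -(2 * R₀) ≤ p 2 ∧ p 2 ≤ h + 2 * R₀ ∧ p 0 ^ 2 + p 1 ^ 2 ≤ ρ ^ 2) →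
      (∀ p, p ∈ P₁ ↔ (p ∈ (fun q => A₁ q + t₁) '' fccStacking 1 (Real.sqrt (2 / 3)) ∧
        -(2 * R₀) ≤ p 2 ∧ p 2 ≤ -R₀ ∧ p 0 ^ 2 + p 1 ^ 2 ≤ ρ ^ 2)) →
      (∀ p, p ∈ P₂ ↔ (p ∈ (fun q => A₂ q + t₂) '' fccStacking 1 (Real.sqrt (2 / 3)) ∧
        h + R₀ ≤ p 2 ∧ p 2 ≤ h + 2 * R₀ ∧ p 0 ^ 2 + p 1 ^ 2 ≤ ρ ^ 2)) →
      (∀ p ∈ X, p 2 < -(2 * R₀) + 1 → p ∈ (fun q => A₁ q + t₁) '' fccStacking 1 (Real.sqrt (2 / 3))) →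
      (∀ p ∈ X, h + 2 * R₀ - 1 < p 2 → p ∈ (fun q => A₂ q + t₂) '' fccStacking 1 (Real.sqrt (2 / 3))) →
      ((((P₁ ×ˢ (X \ P₁)).filter fun pq => dist pq.1 pq.2 = 1).card : ℕ) : ℝ) +
        ((((P₂ ×ˢ ((X \ P₁) \ P₂)).filter fun pq => dist pq.1 pq.2 = 1).card : ℕ) : ℝ) ≤
        contactDeficiency ((X \ P₁) \ P₂) +
          (Real.sqrt 2 / 4 * ∑ᶠ w ∈ {w ∈ fccStacking 1 (Real.sqrt (2 / 3)) | ‖w‖ = 1},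
              |⟪w, A₁.symm (EuclideanSpace.single (2 : Fin 3) (1 : ℝ))⟫_ℝ| +
            Real.sqrt 2 / 4 * ∑ᶠ w ∈ {w ∈ fccStacking 1 (Real.sqrt (2 / 3)) | ‖w‖ = 1},
              |⟪w, A₂.symm (EuclideanSpace.single (2 : Fin 3) (1 : ℝ))⟫_ℝ| -
            Real.sqrt 6 / 4 * Real.sqrt (1 - ⟪L (EuclideanSpace.single (2 : Fin 3) (1 : ℝ)),
              EuclideanSpace.single (2 : Fin 3) (1 : ℝ)⟫_ℝ ^ 2)) * Real.pi * ρ ^ 2 +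
          1 / 2 * ((((X.filter fun e => (e ∈ (fun q => A₁ q + t₁) '' fccStacking 1 (Real.sqrt (2 / 3)) ∧
                e 2 < h + R₀ + 2 ∧ e 0 ^ 2 + e 1 ^ 2 ≤ (ρ - 3) ^ 2) ∧
                e - A₁ w ∈ X ∧ (∀ v ∈ fccSlots, e - A₁ w + A₁ v ∈ X) ∧
                ∃ v ∈ fccSlots, e + A₁ v ∉ X).filter fun e => ∃ n : EuclideanSpace ℝ (Fin 3), ‖n‖ = 1 ∧
              n ≠ L (EuclideanSpace.single (2 : Fin 3) (1 : ℝ)) ∧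
              n ≠ -L (EuclideanSpace.single (2 : Fin 3) (1 : ℝ)) ∧
              (∀ v ∈ fccSlots, ⟪A₁ v, n⟫_ℝ = 0 ∨ ⟪A₁ v, n⟫_ℝ = Real.sqrt (2 / 3) ∨
                ⟪A₁ v, n⟫_ℝ = -Real.sqrt (2 / 3)) ∧
              ⟪A₁ w, n⟫_ℝ = Real.sqrt (2 / 3) ∧
              (∀ v ∈ fccSlots, ⟪A₁ v, n⟫_ℝ ≤ 0 → e + A₁ v ∈ X) ∧
              (∀ v ∈ fccSlots, 0 < ⟪A₁ v, n⟫_ℝ → e + A₁ v ∉ X ∧ e - A₁ v + (2 * ⟪A₁ v, n⟫_ℝ) • n ∈ X)).card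
              : ℕ) : ℝ) +
          C * (1 + h) * ρ := by
  obtain ⟨L, s₁, s₂, σ, σ', hσ, hσ', h₁, h₂⟩ := hcoax
  obtain ⟨w, hw, hw0, hwup, C, R₀, hR₀, key⟩ :=
    coaxialTwoSlabAdhesion_modulo_foreignCaps_certified hs₀ hcert A₁ t₁ A₂ t₂ L s₁ hσ h₁ hne
  exact ⟨L, s₁, s₂, σ, σ', hσ, hσ', h₁, h₂, w, hw, hw0, hwup, C, R₀, hR₀, key⟩

end Summit.Ventures.Crystal3D.Theorems

end
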